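import Summits.ResolutionOfSingularities.ResolutionOfSingularities.Theorems.UniformComplexityCampaignW82FamilyResolution
import Mathlib.AlgebraicGeometry.Morphisms.Smooth
import Mathlib.AlgebraicGeometry.Fiber
import Mathlib.RingTheory.RingHom.Flat
import HarnessLib

/-!
# [OURS · L1 W8.2] RESOLUTION IN FAMILIES, «ONE CLOSED FIBRE» FORM — campaign statements (door 2,
# `UniformComplexity` / `PrimeModelTransfer`), Theses-free module

Cell `res-hironaka` (run/shared/lean/pub/res-hironaka/), LADDER-RESOLUTION rung L (RESCUE), slot W8.2 of
plan/RESCUE-SEED.md («PRIME-FIELD / UNIVERSALITY TRANSFER instead of descent: resolve over 𝔽_p or 𝔽̄_p and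
transfer FAMILIES»). SECOND DOOR: route `UniformComplexity`, item `PrimeModelTransfer`
(stmt-ResolutionOfSingularities-8933: for a prime `p`, resolution of integral separated finite-type schemes over
the algebraically closed fields ALGEBRAIC over `𝔽_p` ⇒ the same over EVERY algebraically closed field of
characteristic `p`). Self-typed by the slot's prover res-L1-s82-pv-2 (gen 6) under the rung-B precedent, as a
sequel to the gen-5 module `Theorems/UniformComplexityCampaignW82FamilyResolution.lean` (p526769:
`CampaignW82.IsWeakResolution`, `CampaignW82.FamilyResolution k`), whose family form is kernel-checked
EQUIVALENT to the crux slice (`CampaignW82.algClosedRes_iff_familyResolution`,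
`CampaignW82.primeModelTransfer_iff_familyResolution`, p530650/p532272). NOTHING is proved about resolution of
singularities here and nothing is asserted: two `def`s and two pure-logic anchors.

WHY THIS FILE. `FamilyResolution k` asks, after an algebraic finite-type base extension `A → A'`, for ONE
morphism `G : 𝒴 → 𝒳 ×_A Spec A'` whose fibre over EVERY field-valued point of `Spec A'` is a weak resolution.
The closed-fibre analysis of the crux kernel (tree file
`Summits/…/Cruxes/PrimeFieldToPerfect/KERNEL-c3.md` §1 «ONE SMOOTH CLOSED FIBRE SUFFICES (E7)», targets
(5.1)/(5.5); EGA IV₃ 12.2.4 (iii) / IV₄ 17.5.1, in the tree as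
`Literature.AlgebraicGeometry.Morphisms.exists_smooth_morphismRestrict_of_smooth_fiber`,
file `Literature/AlgebraicGeometry/Morphisms/OpenSmoothFibreLocus.lean`) says that far less data should
suffice: a proper modification `G` of the extended family which is FLAT over the base along ONE CLOSED fibre,
that single closed fibre being SMOOTH (over the residue field, a finite extension of `k`; for `k = 𝔽̄_p`: one
resolved `𝔽̄_p`-variety in the modified family), and an isomorphism over an open of `𝒳 ×_A Spec A'`
meeting that fibre. This module types the two corresponding statements:

* `SmoothFamilyResolution k` — the STRONG family form: `G` proper, the composite `𝒴 → Spec A'` SMOOTH,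
  `G` an isomorphism over an open `W` meeting EVERY fibre of `𝒳 ×_A Spec A' → Spec A'` (this is what the
  gen-5 spreading theorem `PrimeModelTransfer.exists_familyResolution_datum`, p529834, actually constructs
  before passing to fibres);
* `FamilyResolutionOneFibre k` — the WEAK («one closed fibre») family form: `G` proper, an isomorphism
  over an open `W` meeting the fibre over ONE closed point `s ∈ Spec A'`, the composite `𝒴 → Spec A'` flat
  at the points over `s`, and its fibre over `s` smooth over `κ(s)`.

THEOREMS OF THE PROVER (NOT proved here; gen 6 targets, sibling files
`Theorems/UniformComplexityPrimeModelTransferSmoothFamilySpread.lean`,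
`Theorems/UniformComplexityPrimeModelTransferOfFamilyResolutionOneFibre.lean`, and a Theses-importing links
leaf): for every field `k` of characteristic `p`,
`SmoothFamilyResolution k → FamilyResolution k`, `SmoothFamilyResolution k → FamilyResolutionOneFibre k`
(pick any closed point), `CampaignW82.AlgClosedRes p → SmoothFamilyResolution k` (strengthened spreading),
and — the E7 direction — `FamilyResolutionOneFibre k →` resolution over every algebraically closed `K ⊇ k`
(one smooth closed fibre of the flat proper `𝒴|_V → V` makes `𝒴` smooth over an open `V ∋ s` of
`Spec A'`, which contains the generic point, over which the `K`-point of the crux's variety lies); hence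
all four of `AlgClosedRes p`, `FamilyResolution k`, `SmoothFamilyResolution k`, `FamilyResolutionOneFibre k`
are equivalent, and `Theses.UniformComplexity.PrimeModelTransfer ↔ ∀ p, PrimeClosureRes p →
FamilyResolutionOneFibre (AlgebraicClosure (ZMod p))`.

BUILD RULE (cell, director-resolution 2026-08-26T18:53:29Z (B)): OURS vocabulary file, THESES-FREE BY BIRTH —
imports only the Theses-free gen-5 vocabulary module, Mathlib and `HarnessLib`.

HONEST FRAMING. The `def`s below are OURS — campaign statements that REPLACE THE ROLE of a printed item of
H. Hironaka's manuscript *Resolution of singularities in positive characteristics* (2017-03-23, [Hironaka2017],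
lit key `paper:url-3343fd9e678b`) — namely §17 ¶2, p.89 l.59–62: «In this work the base field K is always
assumed to be a finite field or Z/pZ because our resolution is for all dimension. When the K has transcendence
degree d we can reformulate the resolution problem to the case of dimension d + dim Z.» (typed AS PRINTED, not
asserted, as `S17Methodology.U89_2` / `U89_3`, Literature/AlgebraicGeometry/Hironaka2017/S17Methodology/). The
printed sentence reformulates a variety over a field of transcendence degree `d` as a FAMILY over the prime
field; the statements below say what must be done to such a family — over `𝔽̄_p`-varieties only: ONE closed
fibre resolved, FLATLY — for the reformulation to return a resolution over an algebraically closed field of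
characteristic `p`. Hironaka's statements are CANDIDATES under adjudication (D-0012/D-0089); nothing here is
attributed to the author and no verdict on the manuscript is implied. AI typing, weaker than expert review.

VACUITY SELF-CHECK (for `k` algebraically closed of characteristic `p`): neither statement is trivially true —
at `A = k` the only algebraic finite-type injective extension of the field `k` to a domain is (up to
isomorphism) `k` itself, `Spec A'` is one closed point `s`, flatness over a field is automatic, and the datum
is a proper `G : 𝒴 → 𝒳` with `𝒴` smooth over `k` and `G` an isomorphism over a non-empty open of the given
integral proper `k`-scheme: a resolution of `𝒳`, open in dimension `≥ 4`; neither is trivially false — both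
follow from `AlgClosedRes p` (an instance of the summit conjunct) by the prover's strengthened spreading
theorem; the hypothesis «geometric generic fibre integral» is not idle (same finite-cover example as in the
gen-5 module). The flatness clause of `FamilyResolutionOneFibre` is the hypothesis under which ONE smooth
fibre of a proper family forces smoothness over a neighbourhood of the base point (EGA IV₃ 12.2.4 (iii) /
IV₄ 17.5.1, used at every point of the fibre `q⁻¹(s)`; flatness only at the points of `G⁻¹(W)` over `s`
would give generic smoothness of the generic fibre, not a smooth proper model); nothing is claimed here
about the variant without it (v2 docstring correction, res-L1-s82-pv-2 gen 6: the v1 aside «a resolution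
of the single closed fibre satisfies every other clause» was wrong — the clause «isomorphism over an open
`W` of the TOTAL space meeting the fibre» already excludes morphisms factoring through the closed fibre).

## References (vocabulary and locators only; nothing cited as a premise)
* H. Hironaka, ms. 2017-03-23, §17 ¶2 p.89 l.59–62 — under adjudication, quoted for the role replaced, not
  asserted. [Hironaka2017]
* A. Grothendieck, J. Dieudonné, EGA IV₃ (1966) Thm. 12.2.4 (iii); EGA IV₄ (1967) Thm. 17.5.1 — one smooth
  fibre of a flat proper family (docstring vocabulary for the prover's theorems). [EGAIV3]
* The Stacks Project, Tags 01V8, 01VA. [StacksProject]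
* Tree: `Summits/…/Cruxes/PrimeFieldToPerfect/KERNEL-c3.md` §1, (5.1), (5.5) (lead c3 of crux stmt-15233,
  2026-08-17: «the kernel is a statement about ONE-PARAMETER FAMILIES … and asks for a SIMULTANEOUS RESOLUTION
  OF THE GENERAL CLOSED FIBRES …: smoothness over K_m is automatic from ONE good closed fibre») — cell file, OURS.
-/

noncomputable section

set_option linter.dupNamespace false -- mandated namespace of this single-conjunct summit

open _root_.CategoryTheory _root_.CategoryTheory.Limits _root_.AlgebraicGeometry
open Literature.AlgebraicGeometry.Resolution

namespace Summit.ResolutionOfSingularities.ResolutionOfSingularities.Theorems.CampaignW82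

/-! ## The strong family form: one SMOOTH modified family -/

/-- [OURS · L1 W8.2 door 2] replaces the role of §17 ¶2, p.89 l.59–62 («When the K has transcendence degree d
we can reformulate the resolution problem to the case of dimension d + dim Z» — the variety as a FAMILY over
the prime field; `S17Methodology.U89_3`) by the STRONG form of what such a reformulation must deliver; NOT a
statement of the manuscript. **SMOOTH RESOLUTION IN FAMILIES over `k`.** For every finitely generated
`k`-algebra `A` that is a domain and every PROPER `f : 𝒳 → Spec A` whose GEOMETRIC GENERIC FIBRE
`𝒳 ×_{Spec A} Spec (Frac A)^{alg}` is integral, there exist a domain `A'` with an INJECTIVE, FINITE-TYPE,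
ALGEBRAIC `A`-algebra structure, a scheme `𝒴`, a morphism `G : 𝒴 → 𝒳' := 𝒳 ×_{Spec A} Spec A'` and an open
`W ⊆ 𝒳'` such that: `G` is PROPER; the composite `𝒴 → 𝒳' → Spec A'` is SMOOTH; `G` restricts to an
ISOMORPHISM over `W`; and `W` meets EVERY fibre of `𝒳' → Spec A'` (for every point `s` of `Spec A'` some
`x ∈ W` lies over `s`). Consequences (prover's theorems, sibling files): every field-valued fibre of `G` is a
weak resolution (`SmoothFamilyResolution k → FamilyResolution k`: smooth and proper are stable under base
change, smooth over a field ⇒ regular, «isomorphism over `W`» restricts, `W` meets the fibre); and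
`FamilyResolutionOneFibre k` (take any closed point). Conversely `AlgClosedRes p → SmoothFamilyResolution k`
for `k` of characteristic `p` (the gen-5 spreading theorem p529834 constructs exactly this datum). Barrier
bookkeeping: `𝒴` is smooth over the EXTENDED base `Spec A'`, not over `Spec A` — the algebraic extension
`A → A'` (generically: a finite, in general inseparable, extension of `Frac A`) is where
`RegularNotGeometricallyRegular.lean` / `FrobeniusTwistResolution.lean` are absorbed; a resolution of the
total space `𝒳` is NOT such a datum (its generic fibre is regular, not smooth). Vacuity (`k` algebraically
closed of characteristic `p`): not trivially true (at `A = k` it is resolution of the given integral proper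
`k`-scheme, open in dimension `≥ 4`); not trivially false (⇐ `AlgClosedRes p`). Composite characteristic: not
intended. [folklore] -/
def SmoothFamilyResolution (k : Type) [Field k] : Prop :=
  ∀ (A : Type) [CommRing A] [IsDomain A] [Algebra k A], Algebra.FiniteType k A →
    ∀ (𝒳 : Scheme.{0}) (f : 𝒳 ⟶ Spec (.of A)), IsProper f →
      IsIntegral (pullback f (Spec.map (CommRingCat.ofHom
          (algebraMap A (AlgebraicClosure (FractionRing A)))))) →
      ∃ (A' : Type) (_ : CommRing A') (_ : IsDomain A') (_ : Algebra A A'),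
        Function.Injective (algebraMap A A') ∧ Algebra.FiniteType A A' ∧ Algebra.IsAlgebraic A A' ∧
        ∃ (𝒴 : Scheme.{0})
          (G : 𝒴 ⟶ pullback f (Spec.map (CommRingCat.ofHom (algebraMap A A'))))
          (W : (pullback f (Spec.map (CommRingCat.ofHom (algebraMap A A')))).Opens),
          IsProper G ∧
          Smooth (G ≫ pullback.snd f (Spec.map (CommRingCat.ofHom (algebraMap A A')))) ∧
          IsIso (G ∣_ W) ∧
          ∀ s : ↥(Spec (.of A')), ∃ x : ↥(pullback f (Spec.map (CommRingCat.ofHom (algebraMap A A')))),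
            x ∈ W ∧ (pullback.snd f (Spec.map (CommRingCat.ofHom (algebraMap A A')))) x = s

/-- Anchor (pure logic): `SmoothFamilyResolution k` delivers, for a given proper family with integral
geometric generic fibre, the base extension and the smooth modified family. [folklore] -/
theorem SmoothFamilyResolution.exists_datum {k : Type} [Field k] (h : SmoothFamilyResolution k)
    (A : Type) [CommRing A] [IsDomain A] [Algebra k A] [Algebra.FiniteType k A]
    (𝒳 : Scheme.{0}) (f : 𝒳 ⟶ Spec (.of A)) [IsProper f]
    (hint : IsIntegral (pullback f (Spec.map (CommRingCat.ofHom
      (algebraMap A (AlgebraicClosure (FractionRing A))))))) :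
    ∃ (A' : Type) (_ : CommRing A') (_ : IsDomain A') (_ : Algebra A A'),
      Function.Injective (algebraMap A A') ∧ Algebra.FiniteType A A' ∧ Algebra.IsAlgebraic A A' ∧
      ∃ (𝒴 : Scheme.{0})
        (G : 𝒴 ⟶ pullback f (Spec.map (CommRingCat.ofHom (algebraMap A A'))))
        (W : (pullback f (Spec.map (CommRingCat.ofHom (algebraMap A A')))).Opens),
        IsProper G ∧
        Smooth (G ≫ pullback.snd f (Spec.map (CommRingCat.ofHom (algebraMap A A')))) ∧
        IsIso (G ∣_ W) ∧
        ∀ s : ↥(Spec (.of A')), ∃ x : ↥(pullback f (Spec.map (CommRingCat.ofHom (algebraMap A A')))),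
          x ∈ W ∧ (pullback.snd f (Spec.map (CommRingCat.ofHom (algebraMap A A')))) x = s :=
  h A ‹_› 𝒳 f ‹_› hint

/-! ## The weak family form: ONE smooth closed fibre, flatly -/

/-- [OURS · L1 W8.2 door 2] replaces the role of §17 ¶2, p.89 l.59–62 (the variety over a field of
transcendence degree `d` as a FAMILY over the prime field; `S17Methodology.U89_3`) by the WEAKEST form of what
must be done to such a family — entirely in terms of ONE closed fibre, i.e. of ONE variety over (a finite
extension of) `k`; NOT a statement of the manuscript. **RESOLUTION IN FAMILIES, ONE-CLOSED-FIBRE FORM, over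
`k`.** For every finitely generated `k`-algebra `A` that is a domain and every PROPER `f : 𝒳 → Spec A` whose
geometric generic fibre `𝒳 ×_{Spec A} Spec (Frac A)^{alg}` is integral, there exist a domain `A'` with an
INJECTIVE, FINITE-TYPE, ALGEBRAIC `A`-algebra structure, a scheme `𝒴`, a morphism
`G : 𝒴 → 𝒳' := 𝒳 ×_{Spec A} Spec A'`, an open `W ⊆ 𝒳'` and a CLOSED point `s` of `Spec A'` such that: `G` is
PROPER; `G` restricts to an ISOMORPHISM over `W`; `W` meets the fibre of `𝒳'` over `s`; the composite
`q : 𝒴 → 𝒳' → Spec A'` is FLAT AT THE POINTS OVER `s` (`𝒪_{Spec A', s} → 𝒪_{𝒴, y}` flat whenever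
`q y = s`); and the FIBRE `q⁻¹(s) → Spec κ(s)` (Mathlib `Scheme.Hom.fiberToSpecResidueField`) is SMOOTH —
for `k` algebraically closed, `κ(s) = k` and this says: the closed fibre `𝒴_s` is a regular (= smooth)
`k`-scheme mapping properly onto the `k`-variety `𝒳'_s`, isomorphically over the non-empty open `W_s`, i.e.
(up to non-dominant components) A RESOLUTION OF THE SINGLE `k`-VARIETY `𝒳'_s`, fitted FLATLY into a proper
modification of the family. The prover's theorem (E7 direction, sibling file): `FamilyResolutionOneFibre k`
⇒ resolution over every algebraically closed `K ⊇ k` — by EGA IV₃ 12.2.4 (iii) (tree: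
`Morphisms.exists_smooth_morphismRestrict_of_smooth_fiber`) `q` is smooth over an open `V ∋ s`, `V`
contains the generic point of `Spec A'`, the `K`-point of a `K`-variety spread over `A ⊆ K` lifts to an
INJECTIVE `A' → K` (`IsAlgClosed.lift`; algebraic extensions of domains), i.e. to a point over the generic
point, where the fibre of `G` is then a weak resolution (flat + finite presentation ⇒ open, so `W`, which
meets `q⁻¹(V) ∩ G⁻¹(W) ∋` a point over `s`, also meets the generic fibre). Conversely
`SmoothFamilyResolution k → FamilyResolutionOneFibre k` (any closed point of `Spec A'`). Barrier
bookkeeping: the statement never mentions a generic fibre, an imperfect field or a base change of a regular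
scheme; the inseparability of the crux is in the algebraic extension `A → A'` and in the word FLAT (the
closed fibres of the ORIGINAL family are all singular `k`-varieties when the generic fibre is not smoothable
at level `A` — «arcs inside the discriminant», KERNEL-c3 §1). Vacuity (`k` algebraically closed of
characteristic `p`): not trivially true (at `A = k`: resolution of the given integral proper `k`-scheme);
not trivially false (⇐ `SmoothFamilyResolution k` ⇐ `AlgClosedRes p`); the flatness clause (at ALL points
of `q⁻¹(s)`) is exactly what the prover's E7 argument consumes — it is the EGA IV₃ 12.2.4 (iii)
hypothesis; no claim is made about the flatness-free variant (v2: the v1 aside here was incorrect, see the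
module docstring). Composite characteristic: not intended. [folklore] -/
def FamilyResolutionOneFibre (k : Type) [Field k] : Prop :=
  ∀ (A : Type) [CommRing A] [IsDomain A] [Algebra k A], Algebra.FiniteType k A →
    ∀ (𝒳 : Scheme.{0}) (f : 𝒳 ⟶ Spec (.of A)), IsProper f →
      IsIntegral (pullback f (Spec.map (CommRingCat.ofHom
          (algebraMap A (AlgebraicClosure (FractionRing A)))))) →
      ∃ (A' : Type) (_ : CommRing A') (_ : IsDomain A') (_ : Algebra A A'),
        Function.Injective (algebraMap A A') ∧ Algebra.FiniteType A A' ∧ Algebra.IsAlgebraic A A' ∧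
        ∃ (𝒴 : Scheme.{0})
          (G : 𝒴 ⟶ pullback f (Spec.map (CommRingCat.ofHom (algebraMap A A'))))
          (W : (pullback f (Spec.map (CommRingCat.ofHom (algebraMap A A')))).Opens)
          (s : ↥(Spec (.of A'))),
          IsClosed ({s} : Set ↥(Spec (.of A'))) ∧
          IsProper G ∧
          IsIso (G ∣_ W) ∧
          (∃ x : ↥(pullback f (Spec.map (CommRingCat.ofHom (algebraMap A A')))),
            x ∈ W ∧ (pullback.snd f (Spec.map (CommRingCat.ofHom (algebraMap A A')))) x = s) ∧
          (∀ y : ↥𝒴, (G ≫ pullback.snd f (Spec.map (CommRingCat.ofHom (algebraMap A A')))) y = s →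
            ((G ≫ pullback.snd f (Spec.map (CommRingCat.ofHom (algebraMap A A')))).stalkMap y).hom.Flat) ∧
          Smooth ((G ≫ pullback.snd f (Spec.map (CommRingCat.ofHom (algebraMap A A')))).fiberToSpecResidueField s)

/-- Anchor (pure logic): `FamilyResolutionOneFibre k` delivers, for a given proper family with integral
geometric generic fibre, the base extension, the proper modification, the open, and the one closed point
with its flat smooth fibre. [folklore] -/
theorem FamilyResolutionOneFibre.exists_datum {k : Type} [Field k] (h : FamilyResolutionOneFibre k)
    (A : Type) [CommRing A] [IsDomain A] [Algebra k A] [Algebra.FiniteType k A]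
    (𝒳 : Scheme.{0}) (f : 𝒳 ⟶ Spec (.of A)) [IsProper f]
    (hint : IsIntegral (pullback f (Spec.map (CommRingCat.ofHom
      (algebraMap A (AlgebraicClosure (FractionRing A))))))) :
    ∃ (A' : Type) (_ : CommRing A') (_ : IsDomain A') (_ : Algebra A A'),
      Function.Injective (algebraMap A A') ∧ Algebra.FiniteType A A' ∧ Algebra.IsAlgebraic A A' ∧
      ∃ (𝒴 : Scheme.{0})
        (G : 𝒴 ⟶ pullback f (Spec.map (CommRingCat.ofHom (algebraMap A A'))))
        (W : (pullback f (Spec.map (CommRingCat.ofHom (algebraMap A A')))).Opens)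
        (s : ↥(Spec (.of A'))),
        IsClosed ({s} : Set ↥(Spec (.of A'))) ∧
        IsProper G ∧
        IsIso (G ∣_ W) ∧
        (∃ x : ↥(pullback f (Spec.map (CommRingCat.ofHom (algebraMap A A')))),
          x ∈ W ∧ (pullback.snd f (Spec.map (CommRingCat.ofHom (algebraMap A A')))) x = s) ∧
        (∀ y : ↥𝒴, (G ≫ pullback.snd f (Spec.map (CommRingCat.ofHom (algebraMap A A')))) y = s →
          ((G ≫ pullback.snd f (Spec.map (CommRingCat.ofHom (algebraMap A A')))).stalkMap y).hom.Flat) ∧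
        Smooth ((G ≫ pullback.snd f (Spec.map (CommRingCat.ofHom (algebraMap A A')))).fiberToSpecResidueField s) :=
  h A ‹_› 𝒳 f ‹_› hint

end Summit.ResolutionOfSingularities.ResolutionOfSingularities.Theorems.CampaignW82

end
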